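import Summits.QuantumFields.GaugeBoot.DiagonalRPTorusHalfAction
import Summits.QuantumFields.GaugeBoot.DiagonalRPTorusTubeLayers
import Summits.QuantumFields.GaugeBoot.DiagonalRPTorusFins
import HarnessLib

/-!
# Fins in the rest: which back plaquettes touch a Polyakov column (gauge-boot, task L3 sequel
`d = 3`, `L = 4`; 2/5)

HONEST FRAMING (cell `pub-gaugeboot`, page 1 of every file): the venture produces certified bounds
on lattice expectations at stated coupling, gauge group, dimension and torus size; NOT a mass gap,
NOT a continuum limit, NOT a string tension; NOT Yang–Mills-summit-bearing (barriers
`FixedCouplingUltralocality`, `PerturbativeInvisibility`). This module is bookkeeping for a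
structural NEGATIVE result (`DiagonalRPTorusInnerHalfNegativeThreeAll`); it discharges nothing by
itself.

## Content (three-torus `(ℤ/L)³`, `L = 2c`, `c ≥ 2`, mirror `x₀ = x₁`, threshold `h = c`)

In the trick expansion (`DiagonalRPTorusPolyakovTrick`) the clusters `S` run over the REST
plaquettes `DiagRPTube.restPlaqs 0 1 c` only. A FIN over a column `A ∈ (ℤ/L)²` at height `z` is a
plaquette containing the vertical link `(vsite A z, 2)`; there are four of them, in the planes
`(0,2)` and `(1,2)`, based over `A` or over `A - e_0`, `A - e_1`.

* layers of vertical sites and of the vertices of vertical plaquettes (`lay_vsite`, …);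
  `mem_restPlaqs_of_lay_vert` (a vertex on the back layer `δ = c`);
* **`rest_fin_low`** — for a column `A` on the TOP INNER layer `δ(A) = c - 1`, a rest fin over `A`
  at height `z` is `(vsite A z; 0,2)` (outer column `A + e₀`) or `(vsite (A - e₁) z; 1,2)` (outer
  column `A - e₁`): the two fins towards the back layer; the other two lie inside the half;
* **`rest_fin_high`** — for a column `A'` on the layer `δ(A') = -(c-1)` (the mirror image of the
  top inner layer), a rest fin over `A'` is `(vsite (A' - e₀) z; 0,2)` or `(vsite A' z; 1,2)`;
* the four admissible fins ARE rest plaquettes (`*_mem_restPlaqs`);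
* `links_vsite_plane` — the four links of a vertical plaquette `(vsite B w; a,2)` in column
  coordinates, with the vertical / horizontal specialisations used by the shape analysis
  (`DiagonalRPTorusRestShape`).

Elementary bookkeeping; no named fact.
-/

open Finset Function

namespace Summit.QuantumFields.GaugeBoot

open Literature.MathematicalPhysics.QuantumFieldTheory

namespace DiagRPRest

open DiagRPThree DiagRPPolyakov DiagRPSUN
open DiagRPTube (lay vert restPlaqs lay_shift val_cast val_cast_lt cast_pred_ne_zero neg_cast_c
  not_val_c_lt cast_pred_add_one mem_restPlaqs_of_vert not_mem_restPlaqs_of_layers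
  not_mem_restPlaqs_of_neg_layers)

variable {L : ℕ}

/-! ## Layers of vertical sites and plaquettes -/

section Layers

/-- The layer of a vertical site is the layer `a - b` of its column `(a, b)`. -/
@[simp] theorem lay_vsite (B : ZMod L × ZMod L) (w : ZMod L) :
    lay (0 : Fin 3) 1 (vsite B w) = B.1 - B.2 := by
  simp [DiagRPTube.lay]

/-- `δ(B + e₀) = δ(B) + 1`. -/
theorem lay_bump_zero (B : ZMod L × ZMod L) : (bump 0 B).1 - (bump 0 B).2 = (B.1 - B.2) + 1 := by
  rw [bump_zero]; ring

/-- `δ(B + e₁) = δ(B) - 1`. -/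
theorem lay_bump_one (B : ZMod L × ZMod L) : (bump 1 B).1 - (bump 1 B).2 = (B.1 - B.2) - 1 := by
  rw [bump_one]; ring

/-- `δ(B - e₀) = δ(B) - 1`. -/
theorem lay_unbump_zero (B : ZMod L × ZMod L) :
    (unbump 0 B).1 - (unbump 0 B).2 = (B.1 - B.2) - 1 := by
  simp [unbump]; ring

/-- `δ(B - e₁) = δ(B) + 1`. -/
theorem lay_unbump_one (B : ZMod L × ZMod L) :
    (unbump 1 B).1 - (unbump 1 B).2 = (B.1 - B.2) + 1 := by
  simp [unbump]; ring

/-- The vertices of a plaquette of the plane `(0,2)` lie on the layers `δ(x)`, `δ(x) + 1`. -/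
theorem lay_vert_plane02 (x : Site 3 L) (t : Fin 4) :
    lay (0 : Fin 3) 1 (vert (x, plane02) t) = lay 0 1 x ∨
      lay (0 : Fin 3) 1 (vert (x, plane02) t) = lay 0 1 x + 1 := by
  fin_cases t
  · exact Or.inl rfl
  · right; show lay 0 1 (x.shift 0) = _; rw [lay_shift]; simp
  · left; show lay 0 1 (x.shift 2) = _; rw [lay_shift]; simp
  · right; show lay 0 1 ((x.shift 0).shift 2) = _; rw [lay_shift, lay_shift]; simp

/-- The vertices of a plaquette of the plane `(1,2)` lie on the layers `δ(x)`, `δ(x) - 1`. -/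
theorem lay_vert_plane12 (x : Site 3 L) (t : Fin 4) :
    lay (0 : Fin 3) 1 (vert (x, plane12) t) = lay 0 1 x ∨
      lay (0 : Fin 3) 1 (vert (x, plane12) t) = lay 0 1 x - 1 := by
  fin_cases t
  · exact Or.inl rfl
  · right; show lay 0 1 (x.shift 1) = _; rw [lay_shift]; simp
  · left; show lay 0 1 (x.shift 2) = _; rw [lay_shift]; simp
  · right; show lay 0 1 ((x.shift 1).shift 2) = _; rw [lay_shift, lay_shift]; simp

/-- The second vertex of a `(0,2)`-plaquette lies one layer up. -/
theorem lay_vert_one_plane02 (x : Site 3 L) : lay (0 : Fin 3) 1 (vert (x, plane02) 1) = lay 0 1 x + 1 := by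
  show lay 0 1 (x.shift 0) = _; rw [lay_shift]; simp

/-- The second vertex of a `(1,2)`-plaquette lies one layer down. -/
theorem lay_vert_one_plane12 (x : Site 3 L) : lay (0 : Fin 3) 1 (vert (x, plane12) 1) = lay 0 1 x - 1 := by
  show lay 0 1 (x.shift 1) = _; rw [lay_shift]; simp

variable [NeZero L] {c : ℕ}

/-- **A vertex on the back layer `δ = c` puts the plaquette in the rest** (`L = 2c`, `c ≥ 2`). -/
theorem mem_restPlaqs_of_lay_vert (hc : 2 ≤ c) (hL : L = 2 * c) {q : Plaquette 3 L} (t : Fin 4)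
    (ht : lay (0 : Fin 3) 1 (vert q t) = ((c : ℕ) : ZMod L)) : q ∈ restPlaqs (0 : Fin 3) 1 c := by
  refine mem_restPlaqs_of_vert t ?_ ?_
  · rw [ht]; exact not_val_c_lt hc hL
  · rw [ht, neg_cast_c hL]; exact not_val_c_lt hc hL

/-- A plaquette with all vertices on the layers `c - 2`, `c - 1` is inner, not in the rest. -/
theorem not_mem_restPlaqs_of_low (hc : 2 ≤ c) (hL : L = 2 * c) {q : Plaquette 3 L}
    (hv : ∀ t : Fin 4, lay (0 : Fin 3) 1 (vert q t) = ((c - 1 : ℕ) : ZMod L) ∨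
      lay (0 : Fin 3) 1 (vert q t) = ((c - 2 : ℕ) : ZMod L))
    (h1 : ∃ t : Fin 4, lay (0 : Fin 3) 1 (vert q t) = ((c - 1 : ℕ) : ZMod L)) :
    q ∉ restPlaqs (0 : Fin 3) 1 c := by
  refine not_mem_restPlaqs_of_layers (fun t => ?_) ?_
  · rcases hv t with h | h
    · rw [h]; exact val_cast_lt hL (by omega)
    · rw [h]; exact val_cast_lt hL (by omega)
  · obtain ⟨t, ht⟩ := h1
    exact ⟨t, by rw [ht]; exact cast_pred_ne_zero hc hL⟩

/-- A plaquette with all vertices on the layers `-(c - 2)`, `-(c - 1)` is the mirror image of an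
inner one, not in the rest. -/
theorem not_mem_restPlaqs_of_high (hc : 2 ≤ c) (hL : L = 2 * c) {q : Plaquette 3 L}
    (hv : ∀ t : Fin 4, lay (0 : Fin 3) 1 (vert q t) = -((c - 1 : ℕ) : ZMod L) ∨
      lay (0 : Fin 3) 1 (vert q t) = -((c - 2 : ℕ) : ZMod L))
    (h1 : ∃ t : Fin 4, lay (0 : Fin 3) 1 (vert q t) = -((c - 1 : ℕ) : ZMod L)) :
    q ∉ restPlaqs (0 : Fin 3) 1 c := by
  refine not_mem_restPlaqs_of_neg_layers (fun t => ?_) ?_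
  · rcases hv t with h | h
    · rw [h, neg_neg]; exact val_cast_lt hL (by omega)
    · rw [h, neg_neg]; exact val_cast_lt hL (by omega)
  · obtain ⟨t, ht⟩ := h1
    exact ⟨t, by rw [ht, neg_ne_zero]; exact cast_pred_ne_zero hc hL⟩

omit [NeZero L] in
/-- `(c-1) - 1 = c - 2` in `ℤ/L` (`c ≥ 2`). -/
theorem cast_pred_sub_one (hc : 2 ≤ c) : ((c - 1 : ℕ) : ZMod L) - 1 = ((c - 2 : ℕ) : ZMod L) := by
  rw [sub_eq_iff_eq_add, ← Nat.cast_add_one]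
  congr 1
  omega

end Layers

/-! ## The plane of a vertical plaquette -/

section Plane

/-- A vertical plaquette with horizontal direction `0` lies in the plane `(0,2)`. -/
theorem snd_eq_plane02 {p : Plaquette 3 L} (h2 : p.2.1.2 = 2) (h0 : p.2.1.1 = 0) : p.2 = plane02 :=
  Subtype.ext (Prod.ext h0 h2)

/-- A vertical plaquette with horizontal direction `1` lies in the plane `(1,2)`. -/
theorem snd_eq_plane12 {p : Plaquette 3 L} (h2 : p.2.1.2 = 2) (h1 : p.2.1.1 = 1) : p.2 = plane12 :=
  Subtype.ext (Prod.ext h1 h2)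

/-- A plaquette whose base shifted by `a` is `vsite A z` is based at `vsite (A - e_a) z`. -/
theorem fst_eq_vsite_unbump {p : Plaquette 3 L} {A : ZMod L × ZMod L} {z : ZMod L} {a : Fin 3}
    (ha : a ≠ 2) (h : vsite A z = p.1.shift a) : p.1 = vsite (unbump a A) z := by
  apply shift_injective a
  rw [← h, vsite_shift_of_ne_two _ z ha, bump_unbump]

/-- **The four fins over a column**: a plaquette through the vertical link `(vsite A z, 2)` is
`(vsite A z; 0,2)`, `(vsite (A-e₀) z; 0,2)`, `(vsite A z; 1,2)` or `(vsite (A-e₁) z; 1,2)`. -/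
theorem fin_cases {p : Plaquette 3 L} {A : ZMod L × ZMod L} {z : ZMod L}
    (h : pcnt p (vsite A z, 2) ≠ 0) :
    p = (vsite A z, plane02) ∨ p = (vsite (unbump 0 A) z, plane02) ∨
      p = (vsite A z, plane12) ∨ p = (vsite (unbump 1 A) z, plane12) := by
  obtain ⟨hj, hy⟩ := vertical_of_pcnt_ne_zero h
  have ha := plaq_fst_ne_two p
  rcases eq_zero_or_one_of_ne_two ha with ha0 | ha1
  · have hpl := snd_eq_plane02 hj ha0
    rcases hy with hy | hy
    · rw [ha0] at hy
      exact Or.inr (Or.inl (Prod.ext (fst_eq_vsite_unbump (by decide) hy) hpl))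
    · exact Or.inl (Prod.ext hy.symm hpl)
  · have hpl := snd_eq_plane12 hj ha1
    rcases hy with hy | hy
    · rw [ha1] at hy
      exact Or.inr (Or.inr (Or.inr (Prod.ext (fst_eq_vsite_unbump (by decide) hy) hpl)))
    · exact Or.inr (Or.inr (Or.inl (Prod.ext hy.symm hpl)))

end Plane

/-! ## Rest fins over the two layers of the witness -/

section RestFins

variable [NeZero L] {c : ℕ}

/-- ★ **Rest fins over the top inner layer.** `L = 2c`, `c ≥ 2`, `δ(A) = c - 1`: a REST plaquette
through the vertical link over `A` at height `z` is `(vsite A z; 0,2)` or `(vsite (A - e₁) z; 1,2)`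
(both lean on the back layer `δ = c`; the fins `(vsite (A - e₀) z; 0,2)`, `(vsite A z; 1,2)` lie
inside the half). -/
theorem rest_fin_low (hc : 2 ≤ c) (hL : L = 2 * c) {A : ZMod L × ZMod L}
    (hA : A.1 - A.2 = ((c - 1 : ℕ) : ZMod L)) {p : Plaquette 3 L} {z : ZMod L}
    (hp : p ∈ restPlaqs (0 : Fin 3) 1 c) (h : pcnt p (vsite A z, 2) ≠ 0) :
    p = (vsite A z, plane02) ∨ p = (vsite (unbump 1 A) z, plane12) := by
  rcases fin_cases h with hq | hq | hq | hq
  · exact Or.inl hq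
  · exfalso
    subst hq
    refine not_mem_restPlaqs_of_low hc hL (fun t => ?_) ⟨1, ?_⟩ hp
    · rcases lay_vert_plane02 (vsite (unbump 0 A) z) t with ht | ht
      · right; rw [ht, lay_vsite, lay_unbump_zero, hA, cast_pred_sub_one hc]
      · left; rw [ht, lay_vsite, lay_unbump_zero, hA, sub_add_cancel]
    · rw [lay_vert_one_plane02, lay_vsite, lay_unbump_zero, hA, sub_add_cancel]
  · exfalso
    subst hq
    refine not_mem_restPlaqs_of_low hc hL (fun t => ?_) ⟨0, ?_⟩ hp
    · rcases lay_vert_plane12 (vsite A z) t with ht | ht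
      · left; rw [ht, lay_vsite, hA]
      · right; rw [ht, lay_vsite, hA, cast_pred_sub_one hc]
    · show lay 0 1 (vsite A z) = _
      rw [lay_vsite, hA]
  · exact Or.inr hq

/-- ★ **Rest fins over the mirror image of the top inner layer.** `L = 2c`, `c ≥ 2`,
`δ(A') = -(c - 1)`: a REST plaquette through the vertical link over `A'` at height `z` is
`(vsite (A' - e₀) z; 0,2)` or `(vsite A' z; 1,2)`. -/
theorem rest_fin_high (hc : 2 ≤ c) (hL : L = 2 * c) {A' : ZMod L × ZMod L}
    (hA' : A'.1 - A'.2 = -((c - 1 : ℕ) : ZMod L)) {p : Plaquette 3 L} {z : ZMod L}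
    (hp : p ∈ restPlaqs (0 : Fin 3) 1 c) (h : pcnt p (vsite A' z, 2) ≠ 0) :
    p = (vsite (unbump 0 A') z, plane02) ∨ p = (vsite A' z, plane12) := by
  have e2 : -((c - 1 : ℕ) : ZMod L) + 1 = -((c - 2 : ℕ) : ZMod L) := by
    rw [← cast_pred_sub_one hc]; ring
  rcases fin_cases h with hq | hq | hq | hq
  · exfalso
    subst hq
    refine not_mem_restPlaqs_of_high hc hL (fun t => ?_) ⟨0, ?_⟩ hp
    · rcases lay_vert_plane02 (vsite A' z) t with ht | ht
      · left; rw [ht, lay_vsite, hA']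
      · right; rw [ht, lay_vsite, hA', e2]
    · show lay 0 1 (vsite A' z) = _
      rw [lay_vsite, hA']
  · exact Or.inl hq
  · exact Or.inr hq
  · exfalso
    subst hq
    refine not_mem_restPlaqs_of_high hc hL (fun t => ?_) ⟨1, ?_⟩ hp
    · rcases lay_vert_plane12 (vsite (unbump 1 A') z) t with ht | ht
      · right; rw [ht, lay_vsite, lay_unbump_one, hA', e2]
      · left; rw [ht, lay_vsite, lay_unbump_one, hA', add_sub_cancel_right]
    · rw [lay_vert_one_plane12, lay_vsite, lay_unbump_one, hA', add_sub_cancel_right]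

/-- The fin `(vsite A z; 0,2)` over a top-inner-layer column is a rest plaquette. -/
theorem low02_mem_restPlaqs (hc : 2 ≤ c) (hL : L = 2 * c) {A : ZMod L × ZMod L}
    (hA : A.1 - A.2 = ((c - 1 : ℕ) : ZMod L)) (z : ZMod L) :
    ((vsite A z, plane02) : Plaquette 3 L) ∈ restPlaqs (0 : Fin 3) 1 c :=
  mem_restPlaqs_of_lay_vert hc hL 1 (by
    rw [lay_vert_one_plane02, lay_vsite, hA, cast_pred_add_one hc])

/-- The fin `(vsite (A - e₁) z; 1,2)` over a top-inner-layer column is a rest plaquette. -/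
theorem low12_mem_restPlaqs (hc : 2 ≤ c) (hL : L = 2 * c) {A : ZMod L × ZMod L}
    (hA : A.1 - A.2 = ((c - 1 : ℕ) : ZMod L)) (z : ZMod L) :
    ((vsite (unbump 1 A) z, plane12) : Plaquette 3 L) ∈ restPlaqs (0 : Fin 3) 1 c :=
  mem_restPlaqs_of_lay_vert hc hL 0 (by
    show lay 0 1 (vsite (unbump 1 A) z) = _
    rw [lay_vsite, lay_unbump_one, hA, cast_pred_add_one hc])

/-- The fin `(vsite (A' - e₀) z; 0,2)` over a column of the layer `-(c-1)` is a rest plaquette. -/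
theorem high02_mem_restPlaqs (hc : 2 ≤ c) (hL : L = 2 * c) {A' : ZMod L × ZMod L}
    (hA' : A'.1 - A'.2 = -((c - 1 : ℕ) : ZMod L)) (z : ZMod L) :
    ((vsite (unbump 0 A') z, plane02) : Plaquette 3 L) ∈ restPlaqs (0 : Fin 3) 1 c :=
  mem_restPlaqs_of_lay_vert hc hL 0 (by
    show lay 0 1 (vsite (unbump 0 A') z) = _
    rw [lay_vsite, lay_unbump_zero, hA', ← neg_add', cast_pred_add_one hc, neg_cast_c hL])

/-- The fin `(vsite A' z; 1,2)` over a column of the layer `-(c-1)` is a rest plaquette. -/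
theorem high12_mem_restPlaqs (hc : 2 ≤ c) (hL : L = 2 * c) {A' : ZMod L × ZMod L}
    (hA' : A'.1 - A'.2 = -((c - 1 : ℕ) : ZMod L)) (z : ZMod L) :
    ((vsite A' z, plane12) : Plaquette 3 L) ∈ restPlaqs (0 : Fin 3) 1 c :=
  mem_restPlaqs_of_lay_vert hc hL 1 (by
    rw [lay_vert_one_plane12, lay_vsite, hA', ← neg_add', cast_pred_add_one hc, neg_cast_c hL])

end RestFins

/-! ## The links of a vertical plaquette in column coordinates -/

section Links

/-- **The four links of `(vsite B w; a,2)`**: the bottom rung `(vsite B w, a)`, the outer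
vertical link `(vsite (B+e_a) w, 2)`, the top rung `(vsite B (w+1), a)` and the inner vertical
link `(vsite B w, 2)`. -/
theorem links_vsite_plane (pl : {q : Fin 3 × Fin 3 // q.1 < q.2}) (hpl : pl.1.2 = 2)
    (B : ZMod L × ZMod L) (w : ZMod L) {e : Edge 3 L} (h : pcnt (vsite B w, pl) e ≠ 0) :
    e = (vsite B w, pl.1.1) ∨ e = (vsite (bump pl.1.1 B) w, 2) ∨ e = (vsite B (w + 1), pl.1.1) ∨
      e = (vsite B w, 2) := by
  have hmem := mem_linkList_of_pcnt_ne_zero h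
  unfold linkList at hmem
  simp only [List.mem_cons, List.not_mem_nil, or_false] at hmem
  rw [hpl, vsite_shift_of_ne_two B w (fst_ne_two pl hpl), vsite_shift_two] at hmem
  exact hmem

/-- **Vertical links of a vertical plaquette**: `(vsite B w; a,2)` contains the vertical link over
`C` at height `z` iff `z = w` and `C ∈ {B, B + e_a}`. -/
theorem vertical_link_vsite_plane (pl : {q : Fin 3 × Fin 3 // q.1 < q.2}) (hpl : pl.1.2 = 2)
    (B : ZMod L × ZMod L) (w : ZMod L) {C : ZMod L × ZMod L} {z : ZMod L}
    (h : pcnt (vsite B w, pl) (vsite C z, 2) ≠ 0) : z = w ∧ (C = B ∨ C = bump pl.1.1 B) := by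
  have ha := fst_ne_two pl hpl
  rcases links_vsite_plane pl hpl B w h with e | e | e | e
  · exact absurd (congrArg Prod.snd e).symm ha
  · obtain ⟨hC, hz⟩ := vsite_eq_vsite_iff.1 (congrArg Prod.fst e)
    exact ⟨hz, Or.inr hC⟩
  · exact absurd (congrArg Prod.snd e).symm ha
  · obtain ⟨hC, hz⟩ := vsite_eq_vsite_iff.1 (congrArg Prod.fst e)
    exact ⟨hz, Or.inl hC⟩

/-- **Horizontal links of a vertical plaquette**: `(vsite B w; a,2)` contains the horizontal link
`(vsite C z, k)`, `k ≠ 2`, iff `k = a`, `C = B` and `z ∈ {w, w+1}`. -/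
theorem horizontal_link_vsite_plane (pl : {q : Fin 3 × Fin 3 // q.1 < q.2}) (hpl : pl.1.2 = 2)
    (B : ZMod L × ZMod L) (w : ZMod L) {C : ZMod L × ZMod L} {z : ZMod L} {k : Fin 3} (hk : k ≠ 2)
    (h : pcnt (vsite B w, pl) (vsite C z, k) ≠ 0) : k = pl.1.1 ∧ C = B ∧ (z = w ∨ z = w + 1) := by
  rcases links_vsite_plane pl hpl B w h with e | e | e | e
  · obtain ⟨hC, hz⟩ := vsite_eq_vsite_iff.1 (congrArg Prod.fst e)
    exact ⟨congrArg Prod.snd e, hC, Or.inl hz⟩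
  · exact absurd (congrArg Prod.snd e) hk
  · obtain ⟨hC, hz⟩ := vsite_eq_vsite_iff.1 (congrArg Prod.fst e)
    exact ⟨congrArg Prod.snd e, hC, Or.inr hz⟩
  · exact absurd (congrArg Prod.snd e) hk

/-- A vertical plaquette contains its top rung `(vsite B (w+1), a)`. -/
theorem pcnt_top_rung_ne_zero (pl : {q : Fin 3 × Fin 3 // q.1 < q.2}) (hpl : pl.1.2 = 2)
    (B : ZMod L × ZMod L) (w : ZMod L) :
    pcnt ((vsite B w, pl) : Plaquette 3 L) (vsite B (w + 1), pl.1.1) ≠ 0 := by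
  unfold pcnt
  rw [if_pos (show ((vsite B w : Site 3 L).shift pl.1.2, pl.1.1) = (vsite B (w + 1), pl.1.1) by
    rw [hpl, vsite_shift_two])]
  omega

/-- A vertical plaquette contains its outer vertical link `(vsite (B + e_a) w, 2)`. -/
theorem pcnt_outer_ne_zero (pl : {q : Fin 3 × Fin 3 // q.1 < q.2}) (hpl : pl.1.2 = 2)
    (B : ZMod L × ZMod L) (w : ZMod L) :
    pcnt ((vsite B w, pl) : Plaquette 3 L) (vsite (bump pl.1.1 B) w, 2) ≠ 0 := by
  have h := pcnt_link2_ne_zero ((vsite B w, pl) : Plaquette 3 L)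
  rwa [show (((vsite B w, pl) : Plaquette 3 L).1.shift pl.1.1, pl.1.2) =
    ((vsite (bump pl.1.1 B) w, 2) : Edge 3 L) by
      rw [hpl, vsite_shift_of_ne_two B w (fst_ne_two pl hpl)]] at h

/-- A vertical plaquette contains its inner vertical link `(vsite B w, 2)`. -/
theorem pcnt_inner_ne_zero (pl : {q : Fin 3 × Fin 3 // q.1 < q.2}) (hpl : pl.1.2 = 2)
    (B : ZMod L × ZMod L) (w : ZMod L) :
    pcnt ((vsite B w, pl) : Plaquette 3 L) (vsite B w, 2) ≠ 0 := by
  have h := pcnt_link4_ne_zero ((vsite B w, pl) : Plaquette 3 L)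
  rwa [show (((vsite B w, pl) : Plaquette 3 L).1, pl.1.2) = ((vsite B w, 2) : Edge 3 L) by
    rw [hpl]] at h

/-- A horizontal link lies on no column. -/
theorem ccnt_of_snd_ne_two (A : ZMod L × ZMod L) {e : Edge 3 L} (he : e.2 ≠ 2) : ccnt A e = 0 := by
  unfold ccnt
  rw [if_neg]
  exact fun h => he h.1

end Links

end DiagRPRest

end Summit.QuantumFields.GaugeBoot
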